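import Literature.AlgebraicGeometry.ModuliOfAbelianVarieties.SiegelFineModuliFibreTriples
import Literature.AlgebraicGeometry.ModuliOfAbelianVarieties.SiegelModuliTower
import Literature.AlgebraicGeometry.ModuliOfAbelianVarieties.SymplecticLiftOfMarking
import Literature.AlgebraicGeometry.ModuliOfAbelianVarieties.SiegelAdelicCongrTransport
import Literature.AlgebraicGeometry.AbelianSchemes.PolarizedLevelChange
import HarnessLib

/-!
# Admissibility at `(Z, r)` descends along the level change `P′ ↦ P′.changeLevel`

Layer `Literature/AlgebraicGeometry/ModuliOfAbelianVarieties`, namespace `Literature.AlgebraicGeometry.ModuliOfAbelianVarieties`.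
THEOREMS ONLY (no definition, no named fact, no instance).

Setting of ★ (U) `IsAdmissibleAt hδ r Z hZ P′` (`SiegelModuliComplexUniformisation` :77: a marking `m` of the fibre of `P′`
by `[J(Z), r]` (★ T1′ `SiegelAdelicMarking`), an ample `Θ` with `λ̄ = Λ(𝒪(Θ))`, and a symplectic lift `Λ` of the level
structure whose torsion tower, READ THROUGH `r`, is the marking's: `r⁻¹v ≡ x̃/M (mod ℤ̂^{2g}) ⇒ Λ_M(x) = u(v)`) and of the
App. 7A / [Deligne1971TravauxShimura] 4.16 level tower `P′ ↦ P′.changeLevel N′ d` (★ `PolarizedLevelChange`, cofactor form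
`N = N′ · d`: same abelian scheme, dual pair, polarisation and type; level sections `σ ↦ σ^d`; symplectic lift
`Λ ↦ Λ.changeLevel`, ★ `SymplecticLiftChangeLevel`, whose tower is `[d] ∘ Λ_{dM} ∘ (canonical lift)`).

* `IsAdmissibleAt.changeLevel` — **if a level-`N` triple `P′` over `Spec ℂ` is admissible at `(Z, r)`, so is
  `P′.changeLevel N′ d`** (same `Z`, same `r`): keep `m` and `Θ`, replace `Λ` by `Λ.changeLevel`; the tower clause at a
  level `M` with `N′ ∣ M` is the OLD clause at level `dM` (`N ∣ dM`) read at the canonical lift `x̃` and pushed down by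
  `[d]`: `Λ′_M(x) = Λ_{dM}(x̃)^d = u(v′)^d = u(d v′) = u(v)`, because `d v′` and `v` read the same class `x̃/M`
  (★ readings API of `SymplecticLiftOfMarking` §1, ★ `AdelicCongr.nsmul`, ★ `SiegelAdelicMarking.r_nsmul`).
  [Lan2013PELCompactifications] §1.3.6 Lemma 1.3.6.5 («the same `α̂`, reduced mod `n`»), [Milne2005ShimuraVarieties] §5
  p. 58 / Thm. 6.11 (`Sh_K → Sh_{K′}` for `K ⊂ K′` is `[x, a] ↦ [x, a]` on double cosets: the admissibility datum does not
  change, only the level at which it is read).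
* `isAdmissibleAt_of_classifyingMap_eq_comp_tr` — the consumer form along the Siegel tower ★ `SiegelModuliTower.tr`: if
  `P′` (level `N(K)`) is admissible at `(Z, r)` and `Q` (level `N(K′)`) is classified by `cls P′ ≫ tr f`, then `Q` is
  admissible at `(Z, r)` (★ `classifyingMap_comp_tr` + ★ `isAdmissibleAt_of_classifyingMap_eq`).

Cell `hodgecm-mathlib` (D-0151), E-road residual `stub_noThinPiece`, HECKE-LINK line card v1.1 (B-plan1 (g14)) leaf (L1),
consumer (h2) of socket (A) (B-p08 (g9) / B-p13 (g16)): «the lift `y` of a thick point `s = tr y` reads the same `(Z, r)`».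
Count-neutral capital; HC_CM is proved only modulo the 7 printed citations until rung 0 closes — nothing here is about HC.

## References
* [Lan2013PELCompactifications] K.-W. Lan, *Arithmetic compactifications of PEL-type Shimura varieties* (2013), §1.3.6
  Def. 1.3.6.2 (p. 80), Lemma 1.3.6.5 (p. 81).
* [Milne2005ShimuraVarieties] J. S. Milne, *Introduction to Shimura varieties* (2005), §5 p. 58, §6 Thm. 6.11 pp. 74–75.
* [Deligne1971TravauxShimura] P. Deligne, Travaux de Shimura (1971), 1.8 p. 129, 4.12 (b) p. 149, 4.16 p. 150.
* [MumfordFogartyKirwan1994] D. Mumford, J. Fogarty, F. Kirwan, *GIT* 3rd ed. (1994), App. 7A (p. 235).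
-/

set_option autoImplicit false

noncomputable section

open CategoryTheory CategoryTheory.Limits AlgebraicGeometry Matrix
open Literature.AlgebraicGeometry.Motives (SchemeOver AlgPoints specOver)
open Literature.AlgebraicGeometry.AbelianSchemes (PolarizedAbelianSchemeWithLevel)
open Literature.NumberTheory.Automorphic (siegelUpperHalfSpace)
open Literature.NumberTheory.Adeles (latticeOfGL)

namespace Literature.AlgebraicGeometry.ModuliOfAbelianVarieties

variable {g N : ℕ} {δ : Fin g → ℕ}

/-- **Admissibility at `(Z, r)` descends along the level change.**  If the level-`N` triple `P′` over `Spec ℂ` is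
admissible at `(Z, r)` (marking `m`, ample `Θ`, symplectic lift `Λ` read through `r`), then for `N = N′ · d` the triple
`P′.changeLevel N′ d` (same abelian scheme and polarisation, level sections `σ ↦ σ^d`) is admissible at the SAME `(Z, r)`:
with the same `m` and `Θ` and the lift `Λ.changeLevel`, whose level-`M` layer is `[d] ∘ Λ_{dM} ∘ (canonical lift)` — and
`Λ_{dM}(x̃)^d = u(v′)^d = u(d • v′) = u(v)` since `d • v′` and `v` both read `x̃/M` through `r`.
[cite: Lan2013PELCompactifications, §1.3.6 Def. 1.3.6.2 (p. 80) and Lemma 1.3.6.5 (p. 81)]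
[cite: Milne2005ShimuraVarieties, §5 p. 58 and §6 Thm. 6.11 pp. 74–75] -/
theorem IsAdmissibleAt.changeLevel {hδ : IsPolarizationType δ} {r : gspFinAdelic δ}
    {Z : Matrix (Fin g) (Fin g) ℂ} {hZ : Z ∈ siegelUpperHalfSpace g}
    {P' : PolarizedAbelianSchemeWithLevel g N δ (specOver ℚ ℂ).left} (h : IsAdmissibleAt hδ r Z hZ P')
    (N' d : ℕ) (hd : N = N' * d) (hN : N ≠ 0) :
    IsAdmissibleAt hδ r Z hZ (P'.changeLevel N' d hd hN) := by
  obtain ⟨m, Θ, Λ, hample, hlam, htower⟩ := h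
  have hd0 : d ≠ 0 := by
    rintro rfl
    exact hN (by rw [hd, mul_zero])
  refine ⟨m, Θ, Λ.changeLevel N' d hd hN, hample, hlam, ?_⟩
  intro M hNM hM0 x v hv
  haveI : NeZero M := ⟨hM0⟩
  have hdM0 : d * M ≠ 0 := Nat.mul_ne_zero hd0 hM0
  have hNdM : N ∣ d * M := by
    rw [hd, mul_comm N' d]
    exact Nat.mul_dvd_mul_left d hNM
  -- the canonical lift `x̃` of `x` to `(ℤ/dM)^{2g}` and its `val`
  have hu : ∀ k, (ZMod.cast ((((x k).val : ℕ) : ZMod (d * M))) : ZMod M) = x k := fun k => by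
    rw [ZMod.cast_natCast (dvd_mul_left M d), ZMod.natCast_zmod_val]
  have hval : ∀ k, ((((x k).val : ℕ) : ZMod (d * M))).val = (x k).val := fun k => by
    rw [ZMod.val_natCast]
    exact Nat.mod_eq_of_lt ((ZMod.val_lt (x k)).trans_le (Nat.le_mul_of_pos_left M (Nat.pos_of_ne_zero hd0)))
  -- a reading `v'` of the class `x̃/(dM)` through `r`
  obtain ⟨v', hv'⟩ := exists_adelicCongr_left ((r⁻¹ : gspFinAdelic δ) : GL (Fin g ⊕ Fin g) finAdeleQ) 1
    (fun i => (((((x i).val : ℕ) : ZMod (d * M))).val : ℚ) / ((d * M : ℕ) : ℚ))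
  -- the OLD tower clause at level `dM`, read at `x̃`
  have hold := htower hNdM hdM0 (fun k => (((x k).val : ℕ) : ZMod (d * M))) v' hv'
  -- the new layer is `[d] ∘ Λ_{dM} ∘ x̃`
  rw [Λ.changeLevel_lift N' d hd hN hd0 M]
  refine (Λ.coe_liftPow_ofAdd_of_cast_eq d hd0 hM0 x (fun k => (((x k).val : ℕ) : ZMod (d * M))) hu).trans ?_
  rw [hold, ← m.r_nsmul]
  -- `d • v'` and `v` read the same class `x̃/M`
  refine m.r_eq_r_of_adelicCongr_one (hv'.nsmul d) hv ?_
  have hclass : (d • fun i => (((((x i).val : ℕ) : ZMod (d * M))).val : ℚ) / ((d * M : ℕ) : ℚ)) =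
      fun i => ((x i).val : ℚ) / M := by
    funext i
    rw [Pi.smul_apply, nsmul_eq_mul, hval, Nat.cast_mul, ← mul_div_assoc,
      mul_div_mul_left _ _ (Nat.cast_ne_zero.2 hd0)]
  rw [hclass, sub_self]
  exact zero_mem _

/-- **Admissibility passes DOWN the Siegel tower**: for a family `𝓜` of fine moduli schemes at the Siegel levels and an
arrow `f : K ⟶ K′` (so `N(K′) ∣ N(K)`), if the level-`N(K)` triple `P′` over `Spec ℂ` is admissible at `(Z, r)` and the
level-`N(K′)` triple `Q` is classified by `cls P′ ≫ tr f` (e.g. `Q` is the triple of the image point), then `Q` is admissible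
at `(Z, r)` — `cls P′ ≫ tr f = cls (P′.changeLevel …)` (★ `SiegelModuliTower.classifyingMap_comp_tr`), admissibility is a
property of the classifying point (★ `isAdmissibleAt_of_classifyingMap_eq`), and `IsAdmissibleAt.changeLevel`.
[cite: Milne2005ShimuraVarieties, §5 p. 58 and §6 Thm. 6.11 pp. 74–75] [cite: Deligne1971TravauxShimura, 1.8 p. 129 and 4.16 p. 150] -/
theorem isAdmissibleAt_of_classifyingMap_eq_comp_tr (hg : 0 < g)
    (𝓜 : ∀ K : SiegelLevel δ, SiegelFineModuliScheme g K.N δ) {K K' : SiegelLevel δ} (f : K ⟶ K')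
    {hδ : IsPolarizationType δ} {r : gspFinAdelic δ} {Z : Matrix (Fin g) (Fin g) ℂ} {hZ : Z ∈ siegelUpperHalfSpace g}
    {P' : PolarizedAbelianSchemeWithLevel g K.N δ (specOver ℚ ℂ).left} (hP' : IsAdmissibleAt hδ r Z hZ P')
    (Q : PolarizedAbelianSchemeWithLevel g K'.N δ (specOver ℚ ℂ).left)
    (hQ : haveI : IsLocallyNoetherian (specOver ℚ ℂ).left :=
        inferInstanceAs (IsLocallyNoetherian (Spec (CommRingCat.of ℂ)))
      (𝓜 K').classifyingMap (specOver ℚ ℂ) Q =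
        (𝓜 K).classifyingMap (specOver ℚ ℂ) P' ≫ SiegelModuliTower.tr hg 𝓜 f) :
    IsAdmissibleAt hδ r Z hZ Q := by
  haveI : IsLocallyNoetherian (specOver ℚ ℂ).left := inferInstanceAs (IsLocallyNoetherian (Spec (CommRingCat.of ℂ)))
  rw [SiegelModuliTower.classifyingMap_comp_tr] at hQ
  exact (𝓜 K').isAdmissibleAt_of_classifyingMap_eq hδ _ Q
    (hP'.changeLevel K'.N (K.N / K'.N) (SiegelModuliTower.N_eq_mul_div hg f) (SiegelModuliTower.N_ne_zero K)) hQ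

end Literature.AlgebraicGeometry.ModuliOfAbelianVarieties

end
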